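import Literature.NumberTheory.Automorphic.ResGLnKugaData
import Literature.NumberTheory.Automorphic.ResGLnCartanData
import Literature.Algebra.Lie.ChevalleyEilenbergKugaAdjoint
import HarnessLib

/-!
# Kuga's lemma for `C^•(𝔤, 𝔨 ⊕ ℝ·1; W ⊗ E_λ)`: relative cochains are closed and coclosed once the
# Casimir scalars of `W` and `E_λ` agree

Topic `NumberTheory/Automorphic`; namespace `Literature.NumberTheory.Automorphic.ConeDictionary`
(vocabulary of `ResGLnConeDictionary`, `ResGLnKugaData`, `ResGLnCartanData`).  Definitional
re-typings (defs with bodies) and theorems; no named fact, no `sorry`.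

Step 2 of Borel's injectivity of cuspidal cohomology in the cone model
(`ResGLnCuspidalCohomologyApex`), assembled from the all-degree Kuga lemma
`Literature.Algebra.Lie.ChevalleyEilenbergKugaAdjoint.d_eq_zero_of_casimirOp_eq_zero` fed with
the Cartan data of `ResGLnCartanData` (`x`, `w`, `w'`, `K' = 𝔨 ⊕ ℝ·1`, `hspan`, `hxx`, `hw'`, `hT`)
and the Kuga data of `ResGLnKugaData` (`B = Re(⟨ , ⟩_W ⊗ adm)`, `s = π ⊗ 1 - 1 ⊗ dE_λ`, `hσ`,
`hadj`) [cite: BorelWallach2000, II §2.5, Prop. 3.1]: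

* the Cartan data of `ResGLnCartanData` re-typed over the Lie algebra of the datum (`xD`, `wD`,
  `w'D`, `bD`, `dD`, `kPrimeD`; definitional one-time re-typings as in `ResGLnConeDictionary`) with
  its hypotheses `kugaD_hspan/hxx/hw'/hT` and the symmetry of the canonical tensor `sum_dD_tmul_bD`;
* `kuga_hN` — the Casimir operator of the homotopy for `s = σ₁ - σ₂` over the adapted basis and
  its dual is `C_W ⊗ 1 - 1 ⊗ C_E` (`GKTensor.sum_rTensor_mul_lie`, `sum_lTensor_mul_lie`,
  `mixed_swap` with `Literature.Algebra.Lie.sum_dualBasis_tmul_basis`), `C = GKCasimir.op` the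
  Casimir operator of the real trace form on the two factors; hence it VANISHES when `C_W = c` and
  `C_E = c` are the same scalar;
* **`d_eq_zero_and_coclosed_of_casimir_scalar`** — for a positive Hermitian form `⟨ , ⟩_W` on `W`
  skew along the trace-zero Hermitian `x i` (Petersson), and matching Casimir scalars, EVERY cochain
  of positive degree of `C^•(𝔤, 𝔨 ⊕ ℝ·1; W ⊗ E_λ)` is CLOSED and COCLOSED
  (`casimirHomotopy s x x q η = 0`) — the input `hcoclosed` of the energy argument
  `ChevalleyEilenbergPairedPrimitive.eq_zero_of_pairedPrimitive`.

The two scalar hypotheses are Schur/quasi-simplicity statements on the factors (for `E_λ` see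
`ArchCoeffComplexPlaceCasimir`; for the cusp forms `W` of an irreducible `π` the infinitesimal
character), and their equality is Wigner's lemma (`GKTensor.casimir_scalar_eq_of_cohomology_ne_zero`)
as soon as the relative cohomology is non-zero.

## References

* A. Borel, N. Wallach, *Continuous cohomology, discrete subgroups, and representations of reductive
  groups*, 2nd ed. (2000), II §2.5, Prop. 3.1 (held). [BorelWallach2000]
-/

noncomputable section

namespace Literature.NumberTheory.Automorphic

-- Mathlib idiom (as in `GKModules`): commutator bracket on matrix algebras and `Module.End`
attribute [local instance 100] LieRing.ofAssociativeRing

-- `Classical`: the place subtypes indexing `mixedSpace K` are `Fintype` classically (as in `AdelicGLnGlue`).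
open scoped TensorProduct Classical _root_.Matrix
open Finset _root_.NumberField _root_.NumberField.mixedEmbedding Literature.Algebra.Lie.ChevalleyEilenberg

namespace ConeDictionary

/-! ### The Cartan data re-typed over the Lie algebra of the datum -/

section Retype

variable (n : ℕ) (K : Type) [Field K] [NumberField K] (hcpt : isCompact_glFiniteIntegralLevel n K)

/-- The Lie algebra OF THE DATUM, `(AutomorphyDatum.gl n K hcpt).arch.lie`; definitionally the
`𝔤 = 𝔤𝔩ₙ(K_∞)` of `ResGLnCartanData` (`AutomorphyDatum.gl_arch`), but not reducibly so, whence the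
one-time re-typings below (as in `ResGLnConeDictionary`). [folklore] -/
abbrev 𝔤D : LieSubalgebra ℝ (Matrix (Fin n) (Fin n) (mixedSpace K)) := (AutomorphyDatum.gl n K hcpt).arch.lie

set_option maxHeartbeats 800000 in
-- one-time re-typing over the datum (definitional)
/-- The orthonormal basis `x` of `𝔭₀`, over the datum. [folklore] -/
def xD (i : Fin (ResGLnCartan.pZeroDim n K)) : 𝔤D n K hcpt := ResGLnCartan.x n K i

set_option maxHeartbeats 800000 in
-- as above
/-- The family `w` (basis of `K'`), over the datum. [folklore] -/
def wD (a : Fin (ResGLnCartan.kDim n K)) : 𝔤D n K hcpt := ResGLnCartan.w n K a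

set_option maxHeartbeats 800000 in
-- as above
/-- The family `w'` (dual to `w`), over the datum. [folklore] -/
def w'D (a : Fin (ResGLnCartan.kDim n K)) : 𝔤D n K hcpt := ResGLnCartan.w' n K a

set_option maxHeartbeats 800000 in
-- as above
/-- The adapted basis `b`, over the datum. [folklore] -/
def bD (t : Fin (ResGLnCartan.pZeroDim n K) ⊕ Fin (ResGLnCartan.kDim n K)) : 𝔤D n K hcpt := ResGLnCartan.adaptedBasis n K t

set_option maxHeartbeats 800000 in
-- as above
/-- The dual basis `b^`, over the datum. [folklore] -/
def dD (t : Fin (ResGLnCartan.pZeroDim n K) ⊕ Fin (ResGLnCartan.kDim n K)) : 𝔤D n K hcpt := ResGLnCartan.dualB n K t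

set_option maxHeartbeats 800000 in
-- as above
/-- `K' = 𝔨 ⊕ ℝ·1`, over the datum. [folklore] -/
def kPrimeD : LieSubalgebra ℝ (𝔤D n K hcpt) := ResGLnCartan.kPrime (n := n) (K := K)

set_option maxHeartbeats 800000 in
-- as above
/-- `Sum.elim x w = b`. [folklore] -/
theorem sumElim_xD_wD : Sum.elim (xD n K hcpt) (wD n K hcpt) = bD n K hcpt := by
  funext t
  rcases t with i | a
  · exact congrFun (ResGLnCartan.sumElim_x_w n K) (Sum.inl i)
  · rfl

set_option maxHeartbeats 800000 in
-- as above
/-- `Sum.elim x w' = b^`. [folklore] -/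
theorem sumElim_xD_w'D : Sum.elim (xD n K hcpt) (w'D n K hcpt) = dD n K hcpt := by
  funext t
  rcases t with i | a
  · exact congrFun (ResGLnCartan.sumElim_x_w' n K) (Sum.inl i)
  · rfl

set_option maxHeartbeats 800000 in
-- as above
/-- `w' a ∈ K'`. [folklore] -/
theorem kugaD_hw' (a : Fin (ResGLnCartan.kDim n K)) : w'D n K hcpt a ∈ kPrimeD n K hcpt :=
  ResGLnCartan.kuga_hw' n K a

set_option maxHeartbeats 800000 in
-- as above
/-- `⁅x i, x j⁆ ∈ K'`. [folklore] -/
theorem kugaD_hxx (i j : Fin (ResGLnCartan.pZeroDim n K)) : ⁅xD n K hcpt i, xD n K hcpt j⁆ ∈ kPrimeD n K hcpt :=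
  ResGLnCartan.kuga_hxx n K i j

set_option maxHeartbeats 800000 in
-- as above
/-- `𝔤 = K' + span x`. [folklore] -/
theorem kugaD_hspan (z : 𝔤D n K hcpt) :
    ∃ k ∈ kPrimeD n K hcpt, ∃ c : Fin (ResGLnCartan.pZeroDim n K) → ℝ, z = k + ∑ i, c i • xD n K hcpt i :=
  ResGLnCartan.kuga_hspan n K z

set_option maxHeartbeats 800000 in
-- as above
/-- The invariant-tensor identity `hT`. [folklore] -/
theorem kugaD_hT (z : 𝔤D n K hcpt) :
    ∑ t, (⁅z, Sum.elim (xD n K hcpt) (wD n K hcpt) t⁆ ⊗ₜ[ℝ] Sum.elim (xD n K hcpt) (w'D n K hcpt) t +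
        Sum.elim (xD n K hcpt) (wD n K hcpt) t ⊗ₜ[ℝ] ⁅z, Sum.elim (xD n K hcpt) (w'D n K hcpt) t⁆) =
      (0 : 𝔤D n K hcpt ⊗[ℝ] 𝔤D n K hcpt) :=
  ResGLnCartan.kuga_hT n K z

set_option maxHeartbeats 800000 in
-- as above
/-- Symmetry of the canonical tensor `∑ b_t ⊗ b^t`. [folklore] -/
theorem sum_dD_tmul_bD : ∑ t, dD n K hcpt t ⊗ₜ[ℝ] bD n K hcpt t = ∑ t, bD n K hcpt t ⊗ₜ[ℝ] dD n K hcpt t :=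
  Literature.Algebra.Lie.sum_dualBasis_tmul_basis ResGLnCartan.trForm_nondegenerate ResGLnCartan.trForm_isSymm
    (ResGLnCartan.adaptedBasis n K)

/-- The `x i` are Hermitian. [folklore] -/
theorem conjTranspose_xD (i : Fin (ResGLnCartan.pZeroDim n K)) :
    ((xD n K hcpt i : 𝔤D n K hcpt) : Matrix (Fin n) (Fin n) (mixedSpace K))ᴴ = xD n K hcpt i :=
  congrArg Subtype.val (ResGLnCartan.x_mem n K i).1

end Retype

variable {n : ℕ} {K : Type} [Field K] [NumberField K] {hcpt : isCompact_glFiniteIntegralLevel n K}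
  (π : AutomorphicRepData (AutomorphyDatum.gl n K hcpt)) (lam : (K →+* ℂ) → Fin n → ℤ)

set_option maxHeartbeats 1600000 in
set_option synthInstance.maxHeartbeats 200000 in
-- heavy: the tensor-Casimir identities are transported along the datum's carrier (definitional re-typings)
/-- **Hypothesis `hN`: the Casimir operator of the homotopy for `s = σ₁ - σ₂` vanishes when the
trace-form Casimir operators act on `W` and on `E_λ` by the SAME scalar** — over the adapted basis
`b` of `𝔤` and its trace-dual `b^`, `∑_t s(b_t) θ(b^t) = (C_W ⊗ 1 + M) - (M + 1 ⊗ C_E)`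
(`GKTensor.sum_rTensor_mul_lie`, `sum_lTensor_mul_lie`, `mixed_swap` for the symmetric canonical
tensor) `= c - c' = 0`. [cite: BorelWallach2000, II §2.5, Prop. 3.1] -/
theorem kuga_hN {c c' : ℂ}
    (hc : ∀ v : π.W, GKCasimir.op (AutomorphyDatum.gl n K hcpt).arch π.lieRepW (bD n K hcpt) (dD n K hcpt) v = c • v)
    (hc' : ∀ e : ResGLnCohomology.CoeffModule ℂ n K lam,
      GKCasimir.op (AutomorphyDatum.gl n K hcpt).arch (σ𝔤S hcpt lam) (bD n K hcpt) (dD n K hcpt) e = c' • e)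
    (hcc' : c = c') :
    casimirOp (kugaS π lam) (Sum.elim (xD n K hcpt) (wD n K hcpt)) (Sum.elim (xD n K hcpt) (w'D n K hcpt)) = 0 := by
  rw [sumElim_xD_wD, sumElim_xD_w'D]
  refine LinearMap.ext fun m => ?_
  have e1 : GKCasimir.op (AutomorphyDatum.gl n K hcpt).arch π.lieRepW (bD n K hcpt) (dD n K hcpt) = c • LinearMap.id :=
    LinearMap.ext fun v => hc v
  have e2 : GKCasimir.op (AutomorphyDatum.gl n K hcpt).arch (σ𝔤S hcpt lam) (bD n K hcpt) (dD n K hcpt) = c' • LinearMap.id :=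
    LinearMap.ext fun v => hc' v
  -- the two halves of the Casimir operator of the homotopy, at the level of `W ⊗ E_λ`
  have h1 := LinearMap.congr_fun (GKTensor.sum_rTensor_mul_lie (AutomorphyDatum.gl n K hcpt).arch π.lieRepW
    (bD n K hcpt) (dD n K hcpt) (σ𝔤S hcpt lam)) (m : π.W ⊗[ℂ] ResGLnCohomology.CoeffModule ℂ n K lam)
  have h2 := LinearMap.congr_fun (GKTensor.sum_lTensor_mul_lie (AutomorphyDatum.gl n K hcpt).arch π.lieRepW
    (bD n K hcpt) (dD n K hcpt) (σ𝔤S hcpt lam)) (m : π.W ⊗[ℂ] ResGLnCohomology.CoeffModule ℂ n K lam)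
  have hsw := GKTensor.mixed_swap (AutomorphyDatum.gl n K hcpt).arch π.lieRepW (bD n K hcpt) (dD n K hcpt) (σ𝔤S hcpt lam)
    (sum_dD_tmul_bD n K hcpt)
  rw [hsw, e2, LinearMap.sum_apply, LinearMap.add_apply, LinearMap.lTensor_smul, LinearMap.lTensor_id,
    LinearMap.smul_apply, LinearMap.id_apply] at h2
  rw [e1, LinearMap.sum_apply, LinearMap.add_apply, LinearMap.rTensor_smul, LinearMap.rTensor_id,
    LinearMap.smul_apply, LinearMap.id_apply] at h1
  -- the same two halves, read in the carrier of the complex (definitional re-typing)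
  have h1' : (∑ t, GKTensor.sigmaLeft (AutomorphyDatum.gl n K hcpt).arch π.lieRepW (σ𝔤S hcpt lam) (bD n K hcpt t)
      ⁅dD n K hcpt t, m⁆ : Carrier π lam) =
        c • m + @id (Carrier π lam) (GKTensor.mixed (AutomorphyDatum.gl n K hcpt).arch π.lieRepW (bD n K hcpt) (dD n K hcpt)
          (σ𝔤S hcpt lam) (m : π.W ⊗[ℂ] ResGLnCohomology.CoeffModule ℂ n K lam)) :=
    h1
  have h2' : (∑ t, GKTensor.sigmaRight (AutomorphyDatum.gl n K hcpt).arch π.lieRepW (σ𝔤S hcpt lam) (bD n K hcpt t)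
      ⁅dD n K hcpt t, m⁆ : Carrier π lam) =
        @id (Carrier π lam) (GKTensor.mixed (AutomorphyDatum.gl n K hcpt).arch π.lieRepW (bD n K hcpt) (dD n K hcpt)
          (σ𝔤S hcpt lam) (m : π.W ⊗[ℂ] ResGLnCohomology.CoeffModule ℂ n K lam)) + c' • m :=
    h2
  have e : ∀ t, kugaS π lam (bD n K hcpt t) ⁅dD n K hcpt t, m⁆ =
      GKTensor.sigmaLeft (AutomorphyDatum.gl n K hcpt).arch π.lieRepW (σ𝔤S hcpt lam) (bD n K hcpt t) ⁅dD n K hcpt t, m⁆ -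
        GKTensor.sigmaRight (AutomorphyDatum.gl n K hcpt).arch π.lieRepW (σ𝔤S hcpt lam) (bD n K hcpt t) ⁅dD n K hcpt t, m⁆ :=
    fun t => rfl
  rw [LinearMap.zero_apply, casimirOp_apply]
  simp only [e, sum_sub_distrib]
  rw [h1', h2', hcc']
  abel

set_option maxHeartbeats 1600000 in
set_option synthInstance.maxHeartbeats 200000 in
-- as above
/-- **Kuga's lemma for `C^•(𝔤, 𝔨 ⊕ ℝ·1; W ⊗ E_λ)`** [cite: BorelWallach2000, II §2.5, Prop. 3.1]:
let `⟨ , ⟩_W` be a positive definite Hermitian form on `W` for which the trace-zero Hermitian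
`x i` act skew-adjointly (the Petersson product, `CuspidalPeterssonForm.pet_lieDerivW_left` with
`ResGLnCartan.mixedTrace_trace_x`), and suppose the trace-form Casimir operators act on `W` and on
`E_λ` by the same scalar.  Then every cochain of positive degree of the relative complex for
`K' = 𝔨 ⊕ ℝ·1` is CLOSED and COCLOSED (`h η = 0`, `h` the homotopy of `s = π ⊗ 1 - 1 ⊗ dE_λ` along
the orthonormal basis `x` of `𝔭₀`). -/
theorem d_eq_zero_and_coclosed_of_casimir_scalar {ip : π.W → π.W → ℂ} (hip : Kuga.IsPosForm ip)
    (hskew : ∀ (i : Fin (ResGLnCartan.pZeroDim n K)) (v v' : π.W),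
      ip (π.lieDerivW (xD n K hcpt i) v) v' = -ip v (π.lieDerivW (xD n K hcpt i) v'))
    {c c' : ℂ}
    (hc : ∀ v : π.W, GKCasimir.op (AutomorphyDatum.gl n K hcpt).arch π.lieRepW (bD n K hcpt) (dD n K hcpt) v = c • v)
    (hc' : ∀ e : ResGLnCohomology.CoeffModule ℂ n K lam,
      GKCasimir.op (AutomorphyDatum.gl n K hcpt).arch (σ𝔤S hcpt lam) (bD n K hcpt) (dD n K hcpt) e = c' • e)
    (hcc' : c = c') (q : ℕ) {η : Cochain π lam (q + 1)}
    (hη : η ∈ (Subcomplex.rel ℝ (𝔤D n K hcpt) (Carrier π lam) (kPrimeD n K hcpt)).carrier (q + 1)) :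
    d ℝ (𝔤D n K hcpt) (Carrier π lam) (q + 1) η = 0 ∧
      casimirHomotopy (kugaS π lam) (xD n K hcpt) (xD n K hcpt) q η = 0 :=
  d_eq_zero_of_casimirOp_eq_zero (kugaB_symm π lam hip) (kugaB_self_nonneg π lam hip) (eq_zero_of_kugaB_self π lam hip)
    (kugaD_hspan n K hcpt) (kugaD_hxx n K hcpt)
    (fun i a b => kugaB_lie π lam hip (xD n K hcpt i) (conjTranspose_xD n K hcpt i) (hskew i) a b)
    (kugaD_hw' n K hcpt) (kugaS_equivariant π lam) (kugaD_hT n K hcpt) (kuga_hN π lam hc hc' hcc') q hη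

end ConeDictionary

end Literature.NumberTheory.Automorphic

end
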